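import Summits.QuantumFields.YangMills.Theorems.EquipartitionCriticalityEquipartitionPinsProbeTangentDefs
import Summits.QuantumFields.YangMills.Theorems.EquipartitionCriticalityEquipartitionPinsProbeTangentComb
import Summits.QuantumFields.YangMills.Theorems.EquipartitionCriticalityEquipartitionPinsProbeTangentPlaquetteEnergy
import Summits.QuantumFields.YangMills.Theorems.EquipartitionCriticalityEquipartitionPinsProbeTangentPlaqFieldContinuous
import Summits.QuantumFields.YangMills.Theorems.EquipartitionCriticalityEquipartitionPinsProbeTangentCombPoincare
import Summits.QuantumFields.YangMills.Theorems.EquipartitionCriticalityEquipartitionPinsProbeTangentTangentDefect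
import Summits.QuantumFields.YangMills.Theorems.EquipartitionCriticalityEquipartitionPinsProbeTangentEnergyAlgebra
import Mathlib.Topology.UniformSpace.HeineCantor
import HarnessLib

/-!
# The plaquette energy law `β E_p ≈ ½ |Y_p|²` in probability

Crux `stmt-QuantumFields-8760`
(`Summit.QuantumFields.YangMills.Theses.EquipartitionCriticality.EquipartitionPinsProbe`), line
`Sketch`, stub `stub_energyLaw` (T0') of the reshaped `stub_tangentCore`.

For plaquettes `p_1, …, p_m` of `ℤ⁴` and a bounded continuous `f : ℝ^m → ℝ`, the expectations of
`f((β E_{p_i})_i)` and `f((½ ∑_a (Y_{p_i}^a)²)_i)` under the torus-limit states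
`μ ∈ infiniteVolumeLimitPoints r.ρ β` agree up to `ε` for `β` large, uniformly in `μ`
(`E_p(U) = N − Re tr ρ(U_p)`, `Y = plaqField r β` the rescaled plaquette field in the comb gauge).

Proof (`TangentEnergyLaw.fieldApprox` per plaquette, then Heine–Cantor). With `Ũ = axialFix U`,
`V_p = ρ(Ũ_p)`, `Z_p^a = √β Re tr((V_p − 1) e_a†)`: `E_p(U) = N − Re tr V_p` (conjugation), the
tangent defect bound (`stub_tangentDefect`) gives `0 ≤ β E_p − ½ ∑_a (Z_p^a)² ≤ K (β E_p)² / (2β)`;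
linearisation (`stub_energyAlgebra`) and comb Poincaré (`stub_combPoincare`) give
`|Y_p^a − Z_p^a| ≤ √β K' ∑_{p' ∈ S} E_{p'}`, `S` finite, while `β E_μ[E_{p'}] ≤ 3D/2 + 1` eventually
(`stub_plaquetteEnergy`); so by Markov `|Y − Z| < t` and `β E_p ≤ R` off events of probability
`O(1/√β) + (3D/2+1)/R`, and there `|β E_p − ½|Y_p|²| ≤ η`. Finally `f` is uniformly continuous on
`[−R−1, R+1]^m` and `|∫ f∘u dμ − ∫ f∘v dμ| ≤ ε/4 + 2C μ(bad) < ε`.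
Reference: S. Chatterjee, arXiv:1602.01222, §§9, 11 (axial gauge, linearisation at large `β`).
-/

noncomputable section

open MeasureTheory Filter Topology
open Literature.Probability.LatticeModels Literature.MathematicalPhysics.QuantumLattice
open Literature.MathematicalPhysics.QuantumFieldTheory

namespace Summit.QuantumFields.YangMills.Theorems.EquipartitionPinsProbe

namespace TangentEnergyLaw

/-! ### Deterministic ingredients -/

section Algebra

variable {G : Type} [Group G] [TopologicalSpace G] (r : LatticeRep G)

omit [TopologicalSpace G] in
/-- Conjugation invariance: `Re tr ρ(Ũ_p) = Re tr ρ(U_p)` for the gauge-fixed configuration `Ũ`. -/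
theorem re_trace_holonomy_axialFix {N : ℕ} (ρ : G →* Matrix (Fin N) (Fin N) ℂ) (U : LGConfig 4 G)
    (x : Site 4) (i j : Fin 4) :
    (ρ (plaquetteHolonomyZd (axialFix U) x i j)).trace.re = plaquetteObs ρ x i j U :=
  isZdGaugeInvariant_plaquetteObs ρ x i j (combTransport U) U

/-- **Field defect bound** (linearisation + comb Poincaré): for every plaquette `q` there are a finite
set `S` of plaquettes and `K > 0` with
`|Y_q^a(U) − √β Re tr((ρ(Ũ_q) − 1) e_a†)| ≤ √β K ∑_{p ∈ S} E_p(U)` for all `β`, `U`, `a`. -/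
theorem abs_plaqField_sub_le (q : ZdPlaquette 4) :
    ∃ (S : Finset (ZdPlaquette 4)) (K : ℝ), 0 < K ∧
      ∀ (β : ℝ) (U : LGConfig 4 G) (a : Fin (lieDim r)),
        |plaqField r β U q a - Real.sqrt β *
            lieCoord r (r.ρ (plaquetteHolonomyZd (axialFix U) q.1 q.2.1.1 q.2.1.2) - 1) a| ≤
          Real.sqrt β * K * ∑ p ∈ S, ((r.N : ℝ) - plaquetteObs r.ρ p.1 p.2.1.1 p.2.1.2 U) := by
  obtain ⟨KA, hKA⟩ := stub_energyAlgebra G r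
  choose S C hC0 hC using fun k : Fin 4 => stub_combPoincare G r.ρ r.mem_unitary (plaquetteBoundary q k)
  refine ⟨Finset.univ.biUnion S, (max KA 0 + 1) * (∑ k, C k + 1), mul_pos (by positivity)
    (add_pos_of_nonneg_of_pos (Finset.sum_nonneg fun k _ => hC0 k) one_pos), fun β U a => ?_⟩
  set W : ℝ := ∑ p ∈ Finset.univ.biUnion S, ((r.N : ℝ) - plaquetteObs r.ρ p.1 p.2.1.1 p.2.1.2 U)
  have hE0 : ∀ p : ZdPlaquette 4, 0 ≤ (r.N : ℝ) - plaquetteObs r.ρ p.1 p.2.1.1 p.2.1.2 U := fun p =>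
    TangentPlaquetteEnergy.sub_plaquetteObs_nonneg r.ρ r.mem_unitary _ _ _ U
  have hW0 : 0 ≤ W := Finset.sum_nonneg fun p _ => hE0 p
  have hw0 : ∀ k, 0 ≤ (r.N : ℝ) - (r.ρ (axialFix U (plaquetteBoundary q k))).trace.re := fun k =>
    sub_nonneg.2 (TangentCombPoincare.re_trace_le r.ρ r.mem_unitary _)
  have hwk : ∀ k, (r.N : ℝ) - (r.ρ (axialFix U (plaquetteBoundary q k))).trace.re ≤ C k * W :=
    fun k => (hC k U).trans (mul_le_mul_of_nonneg_left
      (Finset.sum_le_sum_of_subset_of_nonneg (Finset.subset_biUnion_of_mem S (Finset.mem_univ k))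
        fun p _ _ => hE0 p) (hC0 k))
  have hsum : ∑ k : Fin 4, ((r.N : ℝ) - (r.ρ (axialFix U (plaquetteBoundary q k))).trace.re) ≤
      (∑ k, C k + 1) * W :=
    calc _ ≤ ∑ k, C k * W := Finset.sum_le_sum fun k _ => hwk k
      _ = (∑ k, C k) * W := (Finset.sum_mul _ _ _).symm
      _ ≤ (∑ k, C k + 1) * W := by nlinarith
  -- `Y_q^a = √β · curl` (the factor `√β` pulls out of `plaquetteCurl`; cf. the sibling file
  -- `…TangentSecondMoments.plaqField_eq_sqrt_mul`, landed concurrently)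
  have hY : plaqField r β U q a =
      Real.sqrt β * plaquetteCurl (fun e => lieCoord r (r.ρ (axialFix U e) - 1) a) q := by
    simp only [plaqField, linkField, plaquetteCurl, Finset.mul_sum]
    exact Finset.sum_congr rfl fun k _ => by ring
  rw [hY, ← mul_sub, abs_mul, abs_of_nonneg (Real.sqrt_nonneg β), mul_assoc]
  refine mul_le_mul_of_nonneg_left ?_ (Real.sqrt_nonneg β)
  calc _ ≤ KA * ∑ k : Fin 4, ((r.N : ℝ) - (r.ρ (axialFix U (plaquetteBoundary q k))).trace.re) :=
        hKA U q a
    _ ≤ (max KA 0 + 1) * ∑ k : Fin 4, ((r.N : ℝ) - (r.ρ (axialFix U (plaquetteBoundary q k))).trace.re) :=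
        mul_le_mul_of_nonneg_right (by linarith [le_max_left KA 0]) (Finset.sum_nonneg fun k _ => hw0 k)
    _ ≤ (max KA 0 + 1) * ((∑ k, C k + 1) * W) := mul_le_mul_of_nonneg_left hsum (by positivity)
    _ = _ := by ring

/-- **The real-variable core**: from `0 ≤ 2E − ∑ c² ≤ K E²`, `0 ≤ βE ≤ R`, `K R² ≤ β η`,
`D (2R+3) t ≤ η`, `t ≤ 1` and `|Y_a − √β c_a| < t` for all `a`, conclude `|βE − ½ ∑ Y_a²| ≤ η`. -/
theorem abs_sub_half_sum_sq_le {D : ℕ} {β E R η t K : ℝ} {c Y : Fin D → ℝ}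
    (hβ : 0 < β) (hE : 0 ≤ β * E) (hER : β * E ≤ R) (ht1 : t ≤ 1)
    (hB1 : 0 ≤ 2 * E - ∑ a, c a ^ 2) (hB2 : 2 * E - ∑ a, c a ^ 2 ≤ K * E ^ 2) (hK : 0 ≤ K)
    (hKR : K * R ^ 2 ≤ β * η) (htD : D * (2 * R + 3) * t ≤ η)
    (hYZ : ∀ a, |Y a - Real.sqrt β * c a| < t) :
    |β * E - 1 / 2 * ∑ a, Y a ^ 2| ≤ η := by
  have hZ2 : ∑ a, (Real.sqrt β * c a) ^ 2 = β * ∑ a, c a ^ 2 := by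
    simp only [mul_pow, Real.sq_sqrt hβ.le, Finset.mul_sum]
  -- (i) `0 ≤ βE − ½ ∑ Z² ≤ η / 2` with `Z_a = √β c_a`
  have hi1 : 0 ≤ β * E - 1 / 2 * ∑ a, (Real.sqrt β * c a) ^ 2 := by
    rw [hZ2]; nlinarith [mul_nonneg hβ.le hB1]
  have hi2 : β * E - 1 / 2 * ∑ a, (Real.sqrt β * c a) ^ 2 ≤ η / 2 := by
    have h6 : β * (K * E ^ 2) ≤ η := by
      refine le_of_mul_le_mul_left ?_ hβ
      calc β * (β * (K * E ^ 2)) = K * (β * E) ^ 2 := by ring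
        _ ≤ β * η := (mul_le_mul_of_nonneg_left (pow_le_pow_left₀ hE hER 2) hK).trans hKR
    rw [hZ2]; nlinarith [h6, mul_le_mul_of_nonneg_left hB2 hβ.le]
  -- (ii) `|Z_a| ≤ R + 1`
  have hZa : ∀ a, |Real.sqrt β * c a| ≤ R + 1 := fun a => by
    have h8 : (Real.sqrt β * c a) ^ 2 ≤ ∑ b, (Real.sqrt β * c b) ^ 2 :=
      Finset.single_le_sum (f := fun b => (Real.sqrt β * c b) ^ 2) (fun b _ => sq_nonneg _)
        (Finset.mem_univ a)
    nlinarith [sq_abs (Real.sqrt β * c a), sq_nonneg (|Real.sqrt β * c a| - 1),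
      abs_nonneg (Real.sqrt β * c a)]
  -- (iii) `|Z_a² − Y_a²| ≤ (2R + 3) t`
  have hsq : ∀ a, |(Real.sqrt β * c a) ^ 2 - Y a ^ 2| ≤ (2 * R + 3) * t := fun a => by
    rw [sq_sub_sq, abs_mul]
    refine mul_le_mul ?_ ?_ (abs_nonneg _) (by linarith [hE.trans hER])
    · calc |Real.sqrt β * c a + Y a| = |2 * (Real.sqrt β * c a) + (Y a - Real.sqrt β * c a)| := by
            ring_nf
        _ ≤ |2 * (Real.sqrt β * c a)| + |Y a - Real.sqrt β * c a| := abs_add_le _ _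
        _ ≤ 2 * R + 3 := by
            rw [abs_mul, abs_two]
            linarith [hZa a, (hYZ a).le, mul_le_mul_of_nonneg_left (hZa a) zero_le_two]
    · rw [abs_sub_comm]; exact (hYZ a).le
  -- (iv) `|½ ∑ Z² − ½ ∑ Y²| ≤ η / 2`, and conclusion
  have hv : |1 / 2 * ∑ a, (Real.sqrt β * c a) ^ 2 - 1 / 2 * ∑ a, Y a ^ 2| ≤ η / 2 := by
    rw [← mul_sub, ← Finset.sum_sub_distrib, abs_mul, abs_of_pos (by norm_num : (0 : ℝ) < 1 / 2)]
    have h : |∑ a, ((Real.sqrt β * c a) ^ 2 - Y a ^ 2)| ≤ D * ((2 * R + 3) * t) :=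
      (Finset.abs_sum_le_sum_abs _ _).trans ((Finset.sum_le_sum fun a _ => hsq a).trans
        (by rw [Finset.sum_const, Finset.card_univ, Fintype.card_fin, nsmul_eq_mul]))
    nlinarith [htD, h]
  calc |β * E - 1 / 2 * ∑ a, Y a ^ 2|
      = |(β * E - 1 / 2 * ∑ a, (Real.sqrt β * c a) ^ 2) +
          (1 / 2 * ∑ a, (Real.sqrt β * c a) ^ 2 - 1 / 2 * ∑ a, Y a ^ 2)| := by ring_nf
    _ ≤ |β * E - 1 / 2 * ∑ a, (Real.sqrt β * c a) ^ 2| +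
          |1 / 2 * ∑ a, (Real.sqrt β * c a) ^ 2 - 1 / 2 * ∑ a, Y a ^ 2| := abs_add_le _ _
    _ ≤ η / 2 + η / 2 := add_le_add (by rw [abs_of_nonneg hi1]; exact hi2) hv
    _ = η := by ring

end Algebra

/-! ### Probabilistic ingredients -/

section Probability

variable {G : Type} [Group G] [TopologicalSpace G] [IsTopologicalGroup G] [CompactSpace G]
  [MeasurableSpace G] [BorelSpace G] (r : LatticeRep G)

/-- Summing the uniform plaquette energy bound over a finite set of plaquettes. -/
theorem eventually_sum_energy {A : ℝ}
    (hPE : ∀ᶠ β : ℝ in atTop, ∀ μ ∈ infiniteVolumeLimitPoints (d := 4) r.ρ β, ∀ p : ZdPlaquette 4,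
      Integrable (fun U => (r.N : ℝ) - plaquetteObs r.ρ p.1 p.2.1.1 p.2.1.2 U) μ ∧
      β * ∫ U, ((r.N : ℝ) - plaquetteObs r.ρ p.1 p.2.1.1 p.2.1.2 U) ∂μ ≤ A)
    (S : Finset (ZdPlaquette 4)) :
    ∀ᶠ β : ℝ in atTop, ∀ μ ∈ infiniteVolumeLimitPoints (d := 4) r.ρ β,
      Integrable (fun U => ∑ p ∈ S, ((r.N : ℝ) - plaquetteObs r.ρ p.1 p.2.1.1 p.2.1.2 U)) μ ∧
      β * ∫ U, (∑ p ∈ S, ((r.N : ℝ) - plaquetteObs r.ρ p.1 p.2.1.1 p.2.1.2 U)) ∂μ ≤ S.card * A := by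
  filter_upwards [hPE] with β hβ μ hμ
  refine ⟨integrable_finsetSum _ fun p _ => (hβ μ hμ p).1, ?_⟩
  rw [integral_finsetSum _ fun p _ => (hβ μ hμ p).1, Finset.mul_sum]
  calc ∑ p ∈ S, β * ∫ U, ((r.N : ℝ) - plaquetteObs r.ρ p.1 p.2.1.1 p.2.1.2 U) ∂μ
      ≤ ∑ _p ∈ S, A := Finset.sum_le_sum fun p _ => (hβ μ hμ p).2
    _ = S.card * A := by rw [Finset.sum_const, nsmul_eq_mul]

variable [SecondCountableTopology G]

/-- **Per-plaquette energy law in probability.** Given the uniform plaquette energy bound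
`β E_μ[E_p] ≤ A` (eventually in `β`, all `p`), for every plaquette `q`, `R > 0`, `η ∈ (0, 1]` and
`θ > 0`: eventually in `β`, uniformly over the torus-limit states `μ`, off a measurable set of
`μ`-probability `≤ A / R + θ` one has `0 ≤ β E_q ≤ R` and `|β E_q − ½ ∑_a (Y_q^a)²| ≤ η`. -/
theorem fieldApprox {A : ℝ} (hA : 0 ≤ A)
    (hPE : ∀ᶠ β : ℝ in atTop, ∀ μ ∈ infiniteVolumeLimitPoints (d := 4) r.ρ β, ∀ p : ZdPlaquette 4,
      Integrable (fun U => (r.N : ℝ) - plaquetteObs r.ρ p.1 p.2.1.1 p.2.1.2 U) μ ∧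
      β * ∫ U, ((r.N : ℝ) - plaquetteObs r.ρ p.1 p.2.1.1 p.2.1.2 U) ∂μ ≤ A)
    (q : ZdPlaquette 4) {R η θ : ℝ} (hR : 0 < R) (hη : 0 < η) (hη1 : η ≤ 1) (hθ : 0 < θ) :
    ∀ᶠ β : ℝ in atTop, ∀ μ ∈ infiniteVolumeLimitPoints (d := 4) r.ρ β,
      ∃ B : Set (LGConfig 4 G), MeasurableSet B ∧ μ.real B ≤ A / R + θ ∧
        ∀ U ∉ B, 0 ≤ β * ((r.N : ℝ) - plaquetteObs r.ρ q.1 q.2.1.1 q.2.1.2 U) ∧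
          β * ((r.N : ℝ) - plaquetteObs r.ρ q.1 q.2.1.1 q.2.1.2 U) ≤ R ∧
          |β * ((r.N : ℝ) - plaquetteObs r.ρ q.1 q.2.1.1 q.2.1.2 U) -
              1 / 2 * ∑ a, (plaqField r β U q a) ^ 2| ≤ η := by
  obtain ⟨S, K, hK, hYZ⟩ := abs_plaqField_sub_le r q
  obtain ⟨KB, hKB⟩ := stub_tangentDefect G r
  -- the threshold `t` for the field defect and the resulting lower bound `M²` on `β`
  have hden : 0 < (lieDim r : ℝ) * (2 * R + 3) + 1 := by positivity
  set t : ℝ := η / ((lieDim r : ℝ) * (2 * R + 3) + 1) with ht_def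
  have ht : 0 < t := div_pos hη hden
  have ht1 : t ≤ 1 := (div_le_one hden).2 (hη1.trans (le_add_of_nonneg_left (by positivity)))
  have htD : (lieDim r : ℝ) * (2 * R + 3) * t ≤ η := by
    rw [ht_def, ← mul_div_assoc, div_le_iff₀ hden]; nlinarith
  set M : ℝ := K * S.card * A / (t * θ) with hM_def
  have hM : 0 ≤ M := by positivity
  filter_upwards [hPE, eventually_sum_energy r hPE S, eventually_ge_atTop (1 : ℝ),
    eventually_ge_atTop (M ^ 2), eventually_ge_atTop (max KB 0 * R ^ 2 / η)]
    with β hβE hβS hβ1 hβM hβK μ hμ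
  have hβ0 : 0 < β := one_pos.trans_le hβ1
  haveI : IsProbabilityMeasure μ := by
    obtain ⟨L, -, hprob, -⟩ := hμ
    exact hprob
  obtain ⟨hWi, hWβ⟩ := hβS μ hμ
  obtain ⟨hEi, hEβ⟩ := hβE μ hμ q
  have hE0 : ∀ (p : ZdPlaquette 4) (U : LGConfig 4 G),
      0 ≤ (r.N : ℝ) - plaquetteObs r.ρ p.1 p.2.1.1 p.2.1.2 U := fun p U =>
    TangentPlaquetteEnergy.sub_plaquetteObs_nonneg r.ρ r.mem_unitary _ _ _ U
  have hEm : ∀ p : ZdPlaquette 4,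
      Measurable fun U : LGConfig 4 G => (r.N : ℝ) - plaquetteObs r.ρ p.1 p.2.1.1 p.2.1.2 U := fun p =>
    measurable_const.sub (measurable_plaquetteObs r.ρ r.continuous _ _ _)
  refine ⟨{U | R < β * ((r.N : ℝ) - plaquetteObs r.ρ q.1 q.2.1.1 q.2.1.2 U)} ∪
    {U | t ≤ Real.sqrt β * K * ∑ p ∈ S, ((r.N : ℝ) - plaquetteObs r.ρ p.1 p.2.1.1 p.2.1.2 U)},
    (measurableSet_lt measurable_const (measurable_const.mul (hEm q))).union
      (measurableSet_le measurable_const (measurable_const.mul (Finset.measurable_sum _ fun p _ => hEm p))),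
    (measureReal_union_le _ _).trans (add_le_add ?_ ?_), fun U hU => ?_⟩
  · -- Markov for `β E_q`
    have h1 := mul_meas_ge_le_integral_of_nonneg
      (ae_of_all μ fun U => mul_nonneg hβ0.le (hE0 q U)) (hEi.const_mul β) R
    rw [integral_const_mul] at h1
    calc μ.real {U | R < β * ((r.N : ℝ) - plaquetteObs r.ρ q.1 q.2.1.1 q.2.1.2 U)}
        ≤ μ.real {U | R ≤ β * ((r.N : ℝ) - plaquetteObs r.ρ q.1 q.2.1.1 q.2.1.2 U)} :=
          measureReal_mono fun U hU => show R ≤ _ from le_of_lt hU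
      _ ≤ A / R := by rw [le_div_iff₀ hR, mul_comm]; exact h1.trans hEβ
  · -- Markov for the field defect `√β K ∑_{p ∈ S} E_p`
    have h1 := mul_meas_ge_le_integral_of_nonneg
      (ae_of_all μ fun U => mul_nonneg (mul_nonneg (Real.sqrt_nonneg β) hK.le)
        (Finset.sum_nonneg fun p _ => hE0 p U)) (hWi.const_mul (Real.sqrt β * K)) t
    rw [integral_const_mul] at h1
    have h2 : M ≤ Real.sqrt β := by rw [← Real.sqrt_sq hM]; exact Real.sqrt_le_sqrt hβM
    have h3 : Real.sqrt β * Real.sqrt β = β := Real.mul_self_sqrt hβ0.le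
    have h4 : K * S.card * A = M * (t * θ) := by rw [hM_def]; field_simp
    have hsq : 0 < Real.sqrt β := Real.sqrt_pos.2 hβ0
    refine le_of_mul_le_mul_left ?_ (mul_pos ht hsq)
    calc t * Real.sqrt β * μ.real {U | t ≤ Real.sqrt β * K *
          ∑ p ∈ S, ((r.N : ℝ) - plaquetteObs r.ρ p.1 p.2.1.1 p.2.1.2 U)}
        = Real.sqrt β * (t * μ.real {U | t ≤ Real.sqrt β * K *
          ∑ p ∈ S, ((r.N : ℝ) - plaquetteObs r.ρ p.1 p.2.1.1 p.2.1.2 U)}) := by ring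
      _ ≤ Real.sqrt β * (Real.sqrt β * K *
          ∫ U, (∑ p ∈ S, ((r.N : ℝ) - plaquetteObs r.ρ p.1 p.2.1.1 p.2.1.2 U)) ∂μ) :=
          mul_le_mul_of_nonneg_left h1 hsq.le
      _ = K * (Real.sqrt β * Real.sqrt β *
          ∫ U, (∑ p ∈ S, ((r.N : ℝ) - plaquetteObs r.ρ p.1 p.2.1.1 p.2.1.2 U)) ∂μ) := by ring
      _ ≤ K * (S.card * A) := by rw [h3]; exact mul_le_mul_of_nonneg_left hWβ hK.le
      _ = M * (t * θ) := by rw [← h4]; ring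
      _ ≤ Real.sqrt β * (t * θ) := mul_le_mul_of_nonneg_right h2 (by positivity)
      _ = t * Real.sqrt β * θ := by ring
  · -- the deterministic estimate on the good set
    simp only [Set.mem_union, Set.mem_setOf_eq, not_or, not_le, not_lt] at hU
    have hβE0 : 0 ≤ β * ((r.N : ℝ) - plaquetteObs r.ρ q.1 q.2.1.1 q.2.1.2 U) :=
      mul_nonneg hβ0.le (hE0 q U)
    obtain ⟨hB1, hB2⟩ := hKB (plaquetteHolonomyZd (axialFix U) q.1 q.2.1.1 q.2.1.2)
    rw [re_trace_holonomy_axialFix] at hB1 hB2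
    exact ⟨hβE0, hU.1, abs_sub_half_sum_sq_le hβ0 hβE0 hU.1 ht1 hB1
      (hB2.trans (mul_le_mul_of_nonneg_right (le_max_left _ _) (sq_nonneg _))) (le_max_right _ _)
      ((div_le_iff₀ hη).1 hβK) htD fun a => (hYZ β U a).trans_lt hU.2⟩

end Probability

end TangentEnergyLaw

/-- STUB T0' — **the plaquette energy law in probability**: for finitely many plaquettes and a bounded
continuous test function `f`, `E_μ f((β E_{p_i})_i)` and `E_μ f((½|Y_{p_i}|²)_i)` agree up to `ε`
for `β` large, uniformly over the torus-limit states (`TangentEnergyLaw.fieldApprox` per plaquette,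
Heine–Cantor on the box `[−R−1, R+1]^m`, and `|∫ f∘u − ∫ f∘v| ≤ ε/4 + 2C μ(bad)`). -/
theorem stub_energyLaw :
    ∀ (G : Type) [Group G] [TopologicalSpace G] [IsTopologicalGroup G] [CompactSpace G],
      Literature.MathematicalPhysics.QuantumFieldTheory.IsCompactSimpleLieGroup G →
      letI : MeasurableSpace G := borel G
      haveI : BorelSpace G := ⟨rfl⟩
      ∀ r : Literature.MathematicalPhysics.QuantumFieldTheory.LatticeRep G,
        (∀ ε : ℝ, 0 < ε → ∀ᶠ β : ℝ in Filter.atTop,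
          ∀ μ ∈ Literature.MathematicalPhysics.QuantumLattice.infiniteVolumeLimitPoints (d := 4) r.ρ β,
            |β * (∫ U, (∑ i : Fin 4, ∑ j : Fin 4,
                if i < j then ((r.N : ℝ) - Literature.MathematicalPhysics.QuantumLattice.plaquetteObs r.ρ 0 i j U) else 0) ∂μ) -
              3 * (Summit.QuantumFields.YangMills.Theorems.EquipartitionPinsProbe.lieDim r : ℝ) / 2| < ε) →
        ∀ (m : ℕ) (p : Fin m → Literature.MathematicalPhysics.QuantumLattice.ZdPlaquette 4) (f : (Fin m → ℝ) → ℝ),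
          Continuous f → (∃ C : ℝ, ∀ v, |f v| ≤ C) →
          ∀ ε : ℝ, 0 < ε → ∀ᶠ β : ℝ in Filter.atTop,
            ∀ μ ∈ Literature.MathematicalPhysics.QuantumLattice.infiniteVolumeLimitPoints (d := 4) r.ρ β,
              |(∫ U, f (fun i => β * ((r.N : ℝ) -
                  Literature.MathematicalPhysics.QuantumLattice.plaquetteObs r.ρ (p i).1 (p i).2.1.1 (p i).2.1.2 U)) ∂μ) -
                ∫ U, f (fun i => (1 / 2 : ℝ) * ∑ a : Fin (Summit.QuantumFields.YangMills.Theorems.EquipartitionPinsProbe.lieDim r), (Summit.QuantumFields.YangMills.Theorems.EquipartitionPinsProbe.plaqField r β U (p i) a) ^ 2) ∂μ| < ε := by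
  intro G _ _ _ _ hG r hequi m p f hf hfb ε hε
  letI : MeasurableSpace G := borel G
  haveI : BorelSpace G := ⟨rfl⟩
  haveI : SecondCountableTopology G :=
    (r.continuous.isClosedEmbedding r.injective).isEmbedding.secondCountableTopology
  obtain ⟨C, hC⟩ := hfb
  have hC0 : 0 ≤ C := (abs_nonneg _).trans (hC 0)
  -- constants: `A = 3D/2 + 1`, `θ` the target probability of each bad event, `R = A / θ`
  set A : ℝ := 3 * (lieDim r : ℝ) / 2 + 1 with hA_def
  have hA : 0 < A := by positivity
  set θ : ℝ := ε / (16 * (C + 1) * ((m : ℝ) + 1)) with hθ_def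
  have hθ : 0 < θ := by positivity
  have hθ16 : 16 * (C + 1) * ((m : ℝ) + 1) * θ = ε := by rw [hθ_def]; field_simp
  set R : ℝ := A / θ with hR_def
  have hR : 0 < R := div_pos hA hθ
  have hAR : A / R = θ := by rw [hR_def]; field_simp
  -- Heine–Cantor on the box `K = [−R−1, R+1]^m`
  set K : Set (Fin m → ℝ) := Set.pi Set.univ fun _ => Set.Icc (-(R + 1)) (R + 1) with hK_def
  obtain ⟨η', hη', hUC⟩ := Metric.uniformContinuousOn_iff.1
    ((isCompact_univ_pi fun _ => isCompact_Icc).uniformContinuousOn_of_continuous hf.continuousOn)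
    (ε / 4) (by positivity)
  set η : ℝ := min (η' / 2) 1 with hη_def
  have hη : 0 < η := lt_min (half_pos hη') one_pos
  have hηη' : η < η' := (min_le_left _ _).trans_lt (half_lt_self hη')
  -- the per-plaquette events, eventually in `β`, all `i` at once
  have hall := Filter.eventually_all.2 fun i : Fin m =>
    TangentEnergyLaw.fieldApprox r hA.le (stub_plaquetteEnergy G hG r hequi) (p i) hR hη
      (min_le_right _ _) hθ
  filter_upwards [hall] with β hβ μ hμ
  haveI : IsProbabilityMeasure μ := by
    obtain ⟨L, -, hprob, -⟩ := hμ
    exact hprob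
  choose B hBm hBμ hB using fun i => hβ i μ hμ
  -- the two random vectors
  set u : LGConfig 4 G → Fin m → ℝ := fun U i =>
    β * ((r.N : ℝ) - plaquetteObs r.ρ (p i).1 (p i).2.1.1 (p i).2.1.2 U) with hu_def
  set v : LGConfig 4 G → Fin m → ℝ := fun U i =>
    (1 / 2 : ℝ) * ∑ a : Fin (lieDim r), (plaqField r β U (p i) a) ^ 2 with hv_def
  have hum : Measurable u := measurable_pi_lambda u fun i =>
    measurable_const.mul (measurable_const.sub (measurable_plaquetteObs r.ρ r.continuous _ _ _))
  have hvm : Measurable v := by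
    have hc : Continuous fun (Y : ZdPlaquette 4 → Fin (lieDim r) → ℝ) (i : Fin m) =>
        (1 / 2 : ℝ) * ∑ a, (Y (p i) a) ^ 2 :=
      continuous_pi fun i => continuous_const.mul (continuous_finsetSum _ fun a _ =>
        ((continuous_apply a).comp (continuous_apply (p i))).pow 2)
    exact hc.measurable.comp (stub_plaqFieldContinuous G r β).1.measurable
  have hfu : Integrable (fun U => f (u U)) μ :=
    Integrable.of_bound (hf.measurable.comp hum).aestronglyMeasurable C
      (ae_of_all μ fun U => by rw [Real.norm_eq_abs]; exact hC _)
  have hfv : Integrable (fun U => f (v U)) μ :=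
    Integrable.of_bound (hf.measurable.comp hvm).aestronglyMeasurable C
      (ae_of_all μ fun U => by rw [Real.norm_eq_abs]; exact hC _)
  -- the bad set
  set bad : Set (LGConfig 4 G) := ⋃ i, B i with hbad_def
  have hbadm : MeasurableSet bad := MeasurableSet.iUnion fun i => hBm i
  have hbadμ : μ.real bad ≤ m * (2 * θ) :=
    calc μ.real bad ≤ ∑ i, μ.real (B i) := measureReal_iUnion_fintype_le _
      _ ≤ ∑ _i : Fin m, (A / R + θ) := Finset.sum_le_sum fun i _ => hBμ i
      _ = m * (2 * θ) := by
          rw [Finset.sum_const, Finset.card_univ, Fintype.card_fin, nsmul_eq_mul, hAR]; ring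
  -- pointwise: `|f(u) − f(v)| ≤ ε/4` on the good set (both vectors in `K`, within `η`), `≤ 2C` always
  have hpt : ∀ U, |f (u U) - f (v U)| ≤ ε / 4 + bad.indicator (fun _ => 2 * C) U := fun U => by
    by_cases hU : U ∈ bad
    · rw [Set.indicator_of_mem hU]
      linarith [hC (u U), hC (v U), abs_sub (f (u U)) (f (v U))]
    rw [Set.indicator_of_notMem hU, add_zero]
    simp only [hbad_def, Set.mem_iUnion, not_exists] at hU
    have hUi : ∀ i, 0 ≤ u U i ∧ u U i ≤ R ∧ |u U i - v U i| ≤ η := fun i => hB i U (hU i)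
    have huK : u U ∈ K := Set.mem_univ_pi.2 fun i =>
      ⟨by linarith [(hUi i).1, hR.le], by linarith [(hUi i).2.1]⟩
    have hvK : v U ∈ K := Set.mem_univ_pi.2 fun i => by
      obtain ⟨h0, hRle, hd⟩ := hUi i
      rw [abs_le] at hd
      exact ⟨by linarith [min_le_right (η' / 2) 1], by linarith [min_le_right (η' / 2) 1]⟩
    have hdist : dist (u U) (v U) < η' :=
      lt_of_le_of_lt ((dist_pi_le_iff hη.le).2 fun i => by rw [Real.dist_eq]; exact (hUi i).2.2) hηη'
    exact le_of_lt (Real.dist_eq (f (u U)) (f (v U)) ▸ hUC (u U) huK (v U) hvK hdist)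
  -- integrate
  have hI : ∫ U, (ε / 4 + bad.indicator (fun _ => 2 * C) U) ∂μ = ε / 4 + 2 * C * μ.real bad := by
    rw [integral_add (integrable_const _) ((integrable_const _).indicator hbadm), integral_const,
      integral_indicator_const _ hbadm, smul_eq_mul, smul_eq_mul, probReal_univ, one_mul, mul_comm]
  have hCm : C * m * θ ≤ (C + 1) * ((m : ℝ) + 1) * θ :=
    mul_le_mul_of_nonneg_right (by nlinarith [(Nat.cast_nonneg m : (0 : ℝ) ≤ m)]) hθ.le
  show |(∫ U, f (u U) ∂μ) - ∫ U, f (v U) ∂μ| < ε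
  calc |(∫ U, f (u U) ∂μ) - ∫ U, f (v U) ∂μ| = |∫ U, (f (u U) - f (v U)) ∂μ| := by
        rw [integral_sub hfu hfv]
    _ ≤ ∫ U, |f (u U) - f (v U)| ∂μ := abs_integral_le_integral_abs
    _ ≤ ∫ U, (ε / 4 + bad.indicator (fun _ => 2 * C) U) ∂μ :=
        integral_mono_of_nonneg (ae_of_all μ fun U => abs_nonneg _)
          ((integrable_const _).add ((integrable_const _).indicator hbadm)) (ae_of_all μ hpt)
    _ = ε / 4 + 2 * C * μ.real bad := hI
    _ ≤ ε / 4 + 2 * C * (m * (2 * θ)) := by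
        linarith [mul_le_mul_of_nonneg_left hbadμ (by positivity : (0 : ℝ) ≤ 2 * C)]
    _ < ε := by nlinarith [hθ16, hCm, hε]

end Summit.QuantumFields.YangMills.Theorems.EquipartitionPinsProbe

end
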